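import Summits.Ventures.GridStability.Lyapunov.StructurePreservingStepRoa
import HarnessLib

/-!
# GridStability/Lyapunov/StructurePreservingSwitchRegion — after the switch / step: the certified
# SYNCHRONISATION REGION of the post-disturbance model at Vu–Turitsyn's PER-EDGE level, from the same
# certificate plus one more rational per-edge check (robustness of the region under the contingency)

Cell `gridfusion` (LADDER-GRIDFUSION), seat gridfusion-lyap-1 (g9), lines «G2.b-NE39SP-N1-SWITCH» / «…-LOADSTEP».
The switching / step theorems (`StructurePreservingSwitchRoa`, `…StepRoa`) follow ONE trajectory (from the
pre-disturbance synchronous state). This file adds the REGION statement for the post-disturbance model: with the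
equilibrium `θ` enclosed by the certificate (`|θᵢ − θ̃ᵢ| < R`), a rational per-edge check
`c′ < w¹ₑ · ratGapR(q̃ₑ, 2R)` certifies `c′ < bᵢⱼ·vtGap(θᵢ − θⱼ)` on every coupled pair — the level hypothesis of this
seat's `vtSublevel_subset_regionOfAttraction` (★★ #91) — where `ratGapR` is a rational lower bound of the gap
UNIFORM over the enclosure (Lipschitz bounds `|cos a − cos b|, |sin a − sin b| ≤ |a − b|`). So the post-contingency
model keeps a certified region `{V ≤ c′} ∩ 𝒫 ∩ leaf` around its new synchronous state, at the per-edge level of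
[cite: VuTuritsyn2016, Appendix 9.3] rather than the uniform `2cos γ − π sin γ` of the switching check.

WHAT IS HERE: `ratGapR` (+ cast lemma), `ratGapR_le_vtGap` (Mathlib's `Real.abs_sin_le_abs`,
`Real.abs_sin_sub_sin_le`, `Real.abs_cos_sub_cos_le`) (the enclosure-robust gap bound), `levelR` (the decidable
per-edge conjunct), **`region_of_checkP`** (phase-space region of attraction of the post-disturbance model at level
`c′`; every `D` through the data `p`), and `region_of_check` (the switching special case `P¹ := f⁰(δ₀)`). THREE COLUMNS: soundness
statements about MODEL MV-3; no sentence here says any grid is stable. Two small definitions (`ratGapR`, `levelR`);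
no named fact; standard axioms.
-/

noncomputable section

open Set Filter Topology Real Finset
open Summit.Ventures.GridStability.Models.StructurePreserving
open Summit.Ventures.GridStability.Models.StructurePreserving.Params
open Literature.MathematicalPhysics.PowerSystems

namespace Summit.Ventures.GridStability.Lyapunov.StructurePreserving.Switch

variable {n m : ℕ}

/-- **Enclosure-robust rational gap bound**: `ratGapR q η = 2(hcos q − η) − (3.141593 − 2|hsin q| + 2η)(|hsin q| + η)`
— a lower bound of `vtGap s` for every `s` within `η` of the half-angle line angle with tangent quotient `q`. [folklore] -/
def ratGapR {K : Type*} [Field K] [LinearOrder K] (q η : K) : K :=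
  2 * (hcos q - η) - (3141593 / 1000000 - 2 * |hsin q| + 2 * η) * (|hsin q| + η)

/-- `ratGapR` commutes with the cast. [folklore] -/
theorem ratGapR_cast (q η : ℚ) : ((ratGapR q η : ℚ) : ℝ) = ratGapR (q : ℝ) (η : ℝ) := by
  unfold ratGapR; push_cast; rw [hcos_cast, hsin_cast]

/-- **The decidable per-edge REGION-LEVEL check** at level `c′` for post-disturbance weights `w1`, certificate
tangents `t1` and enclosure radius `R`: on every listed edge, `w1ₑ = 0` or `c′ < w1ₑ · ratGapR(q̃ₑ, 2R)`. [folklore] -/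
abbrev levelR (c' : ℚ) (src tgt : Fin m → Fin n) (w1 : Fin m → ℚ) (t1 : Fin n → ℚ) (R : ℚ) : Prop :=
  ∀ e, w1 e = 0 ∨ c' < w1 e * ratGapR (quot (t1 (src e)) (t1 (tgt e))) (2 * R)

/-- For `|x| ≤ π`: `sin |x| = |sin x|` (file-local helper; the same statement is proved in
`WSCC9LossySlabRoa.lean`, not imported here). [folklore] -/
private theorem sin_abs_eq_abs_sin {x : ℝ} (hx : |x| ≤ π) : Real.sin |x| = |Real.sin x| := by
  rcases le_total 0 x with h | h
  · rw [abs_of_nonneg h]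
    rw [abs_of_nonneg h] at hx
    rw [abs_of_nonneg (Real.sin_nonneg_of_nonneg_of_le_pi h hx)]
  · rw [abs_of_nonpos h, Real.sin_neg]
    rw [abs_of_nonpos h] at hx
    have : Real.sin x ≤ 0 := by
      have := Real.sin_nonneg_of_nonneg_of_le_pi (by linarith : 0 ≤ -x) hx
      rw [Real.sin_neg] at this; linarith
    rw [abs_of_nonpos this]

/-- **The enclosure-robust gap bound.** For `ab > −1` let `s̃ = 2·arctan a − 2·arctan b` (`|s̃| ≤ π/2`); then for
every `s` with `|s| ≤ π/2` and `|s − s̃| ≤ η` (`η ≥ 0`): `ratGapR (quot a b) η ≤ vtGap s`. [folklore] -/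
theorem ratGapR_le_vtGap {a b s η : ℝ} (hab : -1 < a * b) (hη : 0 ≤ η) (hs : |s| ≤ π / 2)
    (hst : |2 * Real.arctan a - 2 * Real.arctan b| ≤ π / 2)
    (hnear : |s - (2 * Real.arctan a - 2 * Real.arctan b)| ≤ η) :
    ratGapR (quot a b) η ≤ ClassicalModel.LosslessSystem.vtGap s := by
  set st := 2 * Real.arctan a - 2 * Real.arctan b with hst_def
  have hcosq : hcos (quot a b) = Real.cos st := by
    rw [hst_def, two_mul_arctan_sub hab, cos_two_mul_arctan]; rfl
  have hsinq : hsin (quot a b) = Real.sin st := by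
    rw [hst_def, two_mul_arctan_sub hab, sin_two_mul_arctan]; rfl
  unfold ratGapR ClassicalModel.LosslessSystem.vtGap
  rw [hcosq, hsinq]
  have hπ := Real.pi_lt_d6
  have hπ3 := Real.pi_gt_three
  -- Lipschitz pieces
  have h1 : Real.cos st - η ≤ Real.cos s := by
    have := Real.abs_cos_sub_cos_le s st
    have := abs_le.mp (this.trans hnear)
    linarith [this.1]
  have hd : |(abs s - abs st : ℝ)| ≤ η := (abs_abs_sub_abs_le_abs_sub s st).trans hnear
  have h2 : Real.sin |s| ≤ |Real.sin st| + η := by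
    have hl := Real.abs_sin_sub_sin_le |s| |st|
    have := (abs_le.mp (hl.trans hd)).2
    rw [sin_abs_eq_abs_sin (by linarith [abs_nonneg st] : |st| ≤ π)] at this
    linarith
  have h3 : π - 2 * |s| ≤ 3141593 / 1000000 - 2 * |Real.sin st| + 2 * η := by
    have := (abs_le.mp hd).1
    have hss : |Real.sin st| ≤ |st| := Real.abs_sin_le_abs
    linarith
  have h4 : 0 ≤ π - 2 * |s| := by linarith
  have h5 : 0 ≤ Real.sin |s| := Real.sin_nonneg_of_nonneg_of_le_pi (abs_nonneg s) (by linarith [abs_nonneg s])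
  have h6 : 0 ≤ |Real.sin st| + η := by positivity
  have h7 : (π - 2 * |s|) * Real.sin |s| ≤ (3141593 / 1000000 - 2 * |Real.sin st| + 2 * η) * (|Real.sin st| + η) := by
    calc (π - 2 * |s|) * Real.sin |s| ≤ (π - 2 * |s|) * (|Real.sin st| + η) :=
          mul_le_mul_of_nonneg_left h2 h4
      _ ≤ (3141593 / 1000000 - 2 * |Real.sin st| + 2 * η) * (|Real.sin st| + η) :=
          mul_le_mul_of_nonneg_right h3 h6
  linarith

section Region

variable {src tgt : Fin m → Fin n} {w1 : Fin m → ℚ} {P1 : Fin n → ℚ} {t0 : Fin n → ℚ} {r : Fin n}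
  {C : Cert n m}

/-- **THE POST-DISTURBANCE REGION (phase-space form), MODEL MV-3.** Data: edge list, post-disturbance weights `w1`,
balanced injections `P¹`, a certificate passing `C.checkP`, and a level `c′ ≥ 0` passing
`levelR c′ src tgt w1 C.t1 C.R`;
well-formed post-disturbance data `p` on `n ≠ 0` nodes with these couplings and injections; an exact synchronous
angle vector `θ` of `p` within `R` of the certificate's half-angle point with coupled branches inside `2·arctan τγ`
(it EXISTS: `exists_equilibrium_of_checkP`). CLAIM (= this seat's `vtSublevel_subset_regionOfAttraction` with every
hypothesis discharged from the certificate): from every phase point `y` in Vu–Turitsyn's polytope of `θ`, on the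
momentum leaf of `(θ, 0)` (zero load-bus pseudo-frequencies) and with `V(θ; y) ≤ c′`, a global solution of the
phase field exists and EVERY global solution from `y` keeps the polytope, the leaf and `V ≤ c′` for all `t ≥ 0` and
tends to `(θ, 0)`. [cite: VuTuritsyn2016, §IV and Appendix 9.3; Padiyar2013, §3.2] -/
theorem region_of_checkP (hchk : C.checkP src tgt w1 P1 t0 r) {c' : ℚ} (hc'0 : 0 ≤ c')
    (hlev : levelR c' src tgt w1 C.t1 C.R) (hn : n ≠ 0) {p : Params n} (hp : p.WellFormed)
    (hb : p.b = symmetrize (edgeWeight src tgt fun e => (w1 e : ℝ))) (hP0 : ∀ i, p.P0 i = (P1 i : ℝ))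
    {θ : Fin n → ℝ} (hθeq : ∀ i, p.pe θ i = p.P0 i)
    (hθR : ∀ i, |θ i - halfAngle (fun i => (C.t1 i : ℝ)) i| < (C.R : ℝ))
    (hθγ : ∀ i j, i ≠ j → p.b i j ≠ 0 → |θ i - θ j| < 2 * Real.arctan (C.τγ : ℝ))
    {y : (Fin n → ℝ) × (Fin n → ℝ)}
    (hy : y ∈ vtPolytope p θ ∩ constraintSet p θ ∧ phaseEnergy p θ y ≤ (c' : ℝ)) :
    (∃ X : ℝ → (Fin n → ℝ) × (Fin n → ℝ), X 0 = y ∧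
      ∀ T : ℝ, ∀ t ∈ Icc 0 T, HasDerivWithinAt X (phaseField p (X t)) (Icc 0 T) t) ∧
    ∀ X : ℝ → (Fin n → ℝ) × (Fin n → ℝ), X 0 = y →
      (∀ T : ℝ, ∀ t ∈ Icc 0 T, HasDerivWithinAt X (phaseField p (X t)) (Icc 0 T) t) →
      (∀ t, 0 ≤ t → X t ∈ vtPolytope p θ ∩ constraintSet p θ ∧ phaseEnergy p θ (X t) ≤ (c' : ℝ)) ∧
        Tendsto X atTop (𝓝 (θ, 0)) := by
  obtain ⟨⟨hR, hμ, hτ1, hτ1γ, hτγ1, -⟩, hedge, hnode, ⟨hsum, -⟩, -⟩ := hchk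
  set W1 : Fin m → ℝ := fun e => (w1 e : ℝ) with hW1
  set T1 : Fin n → ℝ := fun i => (C.t1 i : ℝ) with hT1
  have hW1nn : ∀ e, 0 ≤ W1 e := fun e => by simp only [hW1]; exact_mod_cast (hedge e).1
  have hbs : ∀ i j, p.b i j = p.b j i := fun i j => by rw [hb]; exact symmetrize_symm _ i j
  have hbnn : ∀ i j, 0 ≤ p.b i j := fun i j => by
    rw [hb]; exact symmetrize_nonneg (edgeWeight_nonneg hW1nn) i j
  have hτγ1' : (C.τγ : ℝ) < 1 := by exact_mod_cast hτγ1
  have hτγ0 : (0 : ℝ) ≤ (C.τγ : ℝ) := by exact_mod_cast hτ1.trans hτ1γ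
  have hγlt : 2 * Real.arctan (C.τγ : ℝ) < π / 2 := two_mul_arctan_lt_pi_div_two hτγ1'
  have hτ1lt : 2 * Real.arctan (C.τ1 : ℝ) < π / 2 :=
    two_mul_arctan_lt_pi_div_two (by exact_mod_cast lt_of_le_of_lt hτ1γ hτγ1)
  have hc₀nn : (0 : ℝ) ≤ hcos (C.τγ : ℝ) := by
    unfold hcos
    apply div_nonneg <;> nlinarith
  -- ω₀ = 0 and the equilibrium
  have hsumP : ∑ i, p.P0 i = 0 := by
    simp_rw [hP0]
    have := congrArg (fun q : ℚ => (q : ℝ)) hsum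
    push_cast at this
    exact this
  have hshift : p.shifted = p := shifted_eq_self_of_sum_P0 p hsumP
  have hθsync : p.IsSyncEquilibrium θ := fun i => by
    have := congrArg (fun q : Params n => q.P0 i) hshift
    simp only [Params.shifted] at this
    rw [this]; exact hθeq i
  -- no self-loops, window
  have hdiag : ∀ i, p.b i i = 0 := fun i => by
    rw [hb]; exact symmetrize_edgeWeight_self src tgt W1 (fun e => (hedge e).2.1) i
  have h0 : ∀ i j, p.b i j ≠ 0 → |θ i - θ j| < π / 2 := by
    intro i j hij
    by_cases h : i = j
    · subst h; exact absurd (hdiag i) hij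
    · exact (hθγ i j h hij).trans hγlt
  -- connectivity
  have hsup : ∀ i, i ≠ r → (C.μ : ℝ) * (C.x i : ℝ)
      ≤ hcos (C.τγ : ℝ) * lapQ src tgt W1 (fun j => (C.x j : ℝ)) i := by
    intro i hi
    have := (Rat.cast_le (K := ℝ)).2 ((hnode i).2 hi)
    rw [Rat.cast_mul, Rat.cast_mul, hcos_cast, lapQ_cast] at this
    exact this
  have hcoer := coercive_of_lapQ src tgt W1 hW1nn r hc₀nn (fun j => (C.x j : ℝ))
    (fun i => by exact_mod_cast (hnode i).1) hsup
  have hconn : p.couplingGraph.Preconnected := by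
    refine preconnected_of_coercive p hbs r (μ := (C.μ : ℝ)) (c₀ := hcos (C.τγ : ℝ))
      (by exact_mod_cast hμ) fun v hv => ?_
    have := hcoer v hv
    rw [hb]
    exact this
  -- the per-edge level at the TRUE equilibrium
  have hc' : ∀ i j, p.b i j ≠ 0 → (c' : ℝ) < p.b i j
      * ClassicalModel.LosslessSystem.vtGap (θ i - θ j) := by
    intro i j hij
    by_cases h : i = j
    · subst h; exact absurd (hdiag i) hij
    have hij' : symmetrize (edgeWeight src tgt W1) i j ≠ 0 := by rw [← hb]; exact hij
    obtain ⟨e, hwe, hor⟩ := exists_ne_zero_edge src tgt W1 hij'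
    have hwe' : w1 e ≠ 0 := fun hh => hwe (by simp [hW1, hh])
    obtain ⟨hp1, hq1, -, -, -, -⟩ := (hedge e).2.2.resolve_left hwe'
    have hlev' := (hlev e).resolve_left hwe'
    have hp1' : (-1 : ℝ) < T1 (src e) * T1 (tgt e) := by simp only [hT1]; exact_mod_cast hp1
    have hq1' : |(T1 (src e) - T1 (tgt e)) / (1 + T1 (src e) * T1 (tgt e))| ≤ (C.τ1 : ℝ) := by
      have := (Rat.cast_le (K := ℝ)).2 hq1
      rw [Rat.cast_abs, quot_cast] at this
      exact this
    have hst : |halfAngle T1 (src e) - halfAngle T1 (tgt e)| ≤ π / 2 :=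
      (abs_halfAngle_sub_le hp1' hq1').trans hτ1lt.le
    have hwpos : 0 < W1 e := lt_of_le_of_ne (hW1nn e) (Ne.symm hwe)
    have hlevR : (c' : ℝ) < W1 e * ratGapR (quot (T1 (src e)) (T1 (tgt e))) (2 * (C.R : ℝ)) := by
      have := (Rat.cast_lt (K := ℝ)).2 hlev'
      rw [Rat.cast_mul, ratGapR_cast, quot_cast] at this
      push_cast at this
      exact this
    have hη : (0 : ℝ) ≤ 2 * (C.R : ℝ) := by
      have : (0 : ℝ) < C.R := by exact_mod_cast hR
      linarith
    -- orientation
    have key : ∀ {u v : Fin n}, src e = u → tgt e = v → p.b u v ≠ 0 → u ≠ v →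
        (c' : ℝ) < p.b u v * ClassicalModel.LosslessSystem.vtGap (θ u - θ v) := by
      intro u v hs ht huv hne
      subst hs; subst ht
      have hnear : |(θ (src e) - θ (tgt e)) - (halfAngle T1 (src e) - halfAngle T1 (tgt e))| ≤ 2 * (C.R : ℝ) := by
        have h1 := hθR (src e); have h2 := hθR (tgt e)
        calc |(θ (src e) - θ (tgt e)) - (halfAngle T1 (src e) - halfAngle T1 (tgt e))|
            = |(θ (src e) - halfAngle T1 (src e)) - (θ (tgt e) - halfAngle T1 (tgt e))| := by ring_nf
          _ ≤ |θ (src e) - halfAngle T1 (src e)| + |θ (tgt e) - halfAngle T1 (tgt e)| := abs_sub _ _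
          _ ≤ 2 * (C.R : ℝ) := by linarith
      have hgap := ratGapR_le_vtGap hp1' hη ((hθγ _ _ hne huv).trans hγlt).le hst hnear
      have hbge : W1 e ≤ p.b (src e) (tgt e) := by
        rw [hb]
        exact (le_edgeWeight_of_edge hW1nn e rfl rfl).trans
          (le_symmetrize_left (edgeWeight_nonneg hW1nn) _ _)
      have hRpos : 0 < ratGapR (quot (T1 (src e)) (T1 (tgt e))) (2 * (C.R : ℝ)) := by
        by_contra hneg
        have hneg := not_lt.mp hneg
        have : W1 e * ratGapR (quot (T1 (src e)) (T1 (tgt e))) (2 * (C.R : ℝ)) ≤ 0 :=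
          mul_nonpos_of_nonneg_of_nonpos hwpos.le hneg
        have hc'0r : (0 : ℝ) ≤ (c' : ℝ) := by exact_mod_cast hc'0
        linarith
      calc (c' : ℝ) < W1 e * ratGapR (quot (T1 (src e)) (T1 (tgt e))) (2 * (C.R : ℝ)) := hlevR
        _ ≤ p.b (src e) (tgt e) * ratGapR (quot (T1 (src e)) (T1 (tgt e))) (2 * (C.R : ℝ)) :=
            mul_le_mul_of_nonneg_right hbge hRpos.le
        _ ≤ p.b (src e) (tgt e) * ClassicalModel.LosslessSystem.vtGap (θ (src e) - θ (tgt e)) :=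
            mul_le_mul_of_nonneg_left hgap (hbnn _ _)
    rcases hor with ⟨hs, ht⟩ | ⟨hs, ht⟩
    · exact key hs ht hij h
    · have hji : p.b j i ≠ 0 := by rwa [hbs] at hij
      have := key hs ht hji (Ne.symm h)
      rw [hbs j i] at this
      rw [show θ i - θ j = -(θ j - θ i) by ring, ClassicalModel.LosslessSystem.vtGap, abs_neg, Real.cos_neg]
      unfold ClassicalModel.LosslessSystem.vtGap at this
      exact this
  exact vtSublevel_subset_regionOfAttraction hp hn hconn hbnn h0 hθsync hc' hy


/-- **The post-SWITCH region** (special case `P¹ := f⁰(δ₀)` of `region_of_checkP`, for certificates of the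
switching check `Cert.check`): with `p.P0ᵢ = f⁰ᵢ(δ₀)` in the real `flowQ` form used by the instance files.
[cite: VuTuritsyn2016, §IV and Appendix 9.3] -/
theorem region_of_check {w0 : Fin m → ℚ} (hchk : C.check src tgt w0 w1 t0 r) {c' : ℚ} (hc'0 : 0 ≤ c')
    (hlev : levelR c' src tgt w1 C.t1 C.R) (hn : n ≠ 0) {p : Params n} (hp : p.WellFormed)
    (hb : p.b = symmetrize (edgeWeight src tgt fun e => (w1 e : ℝ)))
    (hP0 : ∀ i, p.P0 i = flowQ src tgt (fun e => (w0 e : ℝ)) (fun i => (t0 i : ℝ)) i)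
    {θ : Fin n → ℝ} (hθeq : ∀ i, p.pe θ i = p.P0 i)
    (hθR : ∀ i, |θ i - halfAngle (fun i => (C.t1 i : ℝ)) i| < (C.R : ℝ))
    (hθγ : ∀ i j, i ≠ j → p.b i j ≠ 0 → |θ i - θ j| < 2 * Real.arctan (C.τγ : ℝ))
    {y : (Fin n → ℝ) × (Fin n → ℝ)}
    (hy : y ∈ vtPolytope p θ ∩ constraintSet p θ ∧ phaseEnergy p θ y ≤ (c' : ℝ)) :
    (∃ X : ℝ → (Fin n → ℝ) × (Fin n → ℝ), X 0 = y ∧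
      ∀ T : ℝ, ∀ t ∈ Icc 0 T, HasDerivWithinAt X (phaseField p (X t)) (Icc 0 T) t) ∧
    ∀ X : ℝ → (Fin n → ℝ) × (Fin n → ℝ), X 0 = y →
      (∀ T : ℝ, ∀ t ∈ Icc 0 T, HasDerivWithinAt X (phaseField p (X t)) (Icc 0 T) t) →
      (∀ t, 0 ≤ t → X t ∈ vtPolytope p θ ∩ constraintSet p θ ∧ phaseEnergy p θ (X t) ≤ (c' : ℝ)) ∧
        Tendsto X atTop (𝓝 (θ, 0)) := by
  have hP0' : ∀ i, p.P0 i = ((flowQ src tgt w0 t0 i : ℚ) : ℝ) := fun i => by rw [hP0, flowQ_cast]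
  exact region_of_checkP (Cert.checkP_of_check hchk) hc'0 hlev hn hp hb hP0' hθeq hθR hθγ hy

end Region

end Summit.Ventures.GridStability.Lyapunov.StructurePreserving.Switch

end
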